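import Literature.RingTheory.LocalCohomology.CechTorsion
import Mathlib.RingTheory.Regular.RegularSequence
import Mathlib.Algebra.Module.Torsion.Basic
import HarnessLib

/-!
# Local (Čech) cohomology vanishes below the depth

Topic `Literature/RingTheory/LocalCohomology`, sequel of `CechComplex.lean`, `CechTorsion.lean`.
**Theorem** (`cech_exact_of_isRegular`): if the `R`-module `M` admits an `M`-regular sequence
`x_1, …, x_t` with every `x_l ∈ √(y_1, …, y_s)`, then the extended Čech complex
`0 → M → ∏ M_{y_i} → ∏ M_{y_i y_j} → ⋯` is exact in cochain degrees `< t`: `M → ∏ M_{y_i}` is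
injective (`t ≥ 1`), every cocycle of `Č^0` comes from `M` (`t ≥ 2`), every cocycle of `Č^{n+1}`
is a coboundary (`t ≥ n + 3`). This is Grothendieck's "`H^i_Y(M) = 0` pour `i < prof_Y M`" (SGA 2
Exp. III, 3.1–3.3: a regular sequence of length `n+1` in `I` gives `Ext^i(N, M) = 0`, `i ≤ n`,
for `N` killed by a power of `I`) in its Čech form (Eisenbud, *The Geometry of Syzygies*,
Thm. A1.3 with Prop. A1.16 (1): "If `i < depth M` … then `H^i_Q(M) = 0`"), proved here without
derived functors: by induction on `t`, a cocycle `c` has `x^K c` a coboundary for `x = x_1`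
(the classes are `y_j`-power torsion, `CechTorsion.lean`, and `x ∈ √(y)` —
`exists_pow_smul_eq_zero_of_mem_radical`), and the powers of `x` are peeled off one at a time
(`exists_eq_dC_succ_of_pow_smul_eq` etc.) using the exactness of `Č(y; M/xM)` one degree lower
(induction hypothesis, `x_2, …` being `M/xM`-regular — Mathlib's
`RingTheory.Sequence.isRegular_cons_iff`) and the degreewise short exact sequences
`0 → Č(M) →x Č(M) → Č(M/xM) → 0` (`cechObjMap_exact`, `isSMulRegular_cechObj`).

Everything is proved; no named facts. This is the depth input (`H^i_𝔪(A) = 0`, `i < depth A`)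
of the local Lefschetz theorems SGA 2 XI 3.16–3.17 used for Grothendieck's parafactoriality
theorem XI 3.13 (ii) (`Literature/RingTheory/RegularLocalRing/GrothendieckSamuelHypersurface*`).

## References

* [Grothendieck1968SGA2] A. Grothendieck, SGA 2, Exp. III, 3.1–3.3 (arXiv:math/0511279, p. 17).
* [Eisenbud2005] D. Eisenbud, *The Geometry of Syzygies*, GTM 229, Appendix 1, Thm. A1.3,
  Prop. A1.16 (1).
-/

noncomputable section

open CategoryTheory AlgebraicTopology

universe u

namespace Literature.RingTheory.LocalCohomology

variable {R : Type u} [CommRing R] {s : ℕ} (y : Fin s → R) (M : Type u) [AddCommGroup M]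
  [Module R M]

/-! ## Vanishing below the depth -/

section Depth

variable {y M}

open Pointwise

/-! ### Identities of the differentials -/

/-- `d ∘ d = 0`. [folklore] -/
theorem dC_dC (n : ℕ) (a : CechObj y M n) : dC (n + 1) (dC n a) = 0 := by
  show ((cechComplex y M).d n (n + 1) ≫ (cechComplex y M).d (n + 1) (n + 2)).hom a = 0
  rw [(cechComplex y M).d_comp_d]
  rfl

/-- `d ∘ ε = 0`, elementwise. [folklore] -/
theorem dC_cechAug (m : M) : dC 0 (cechAug y M m) = 0 := by
  show (ModuleCat.ofHom (cechAug y M) ≫ (cechComplex y M).d 0 1).hom m = 0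
  rw [cechAug_d]
  rfl

section Naturality

variable {N : Type u} [AddCommGroup N] [Module R N] (φ : M →ₗ[R] N)

/-- The Čech differential is natural in the module. [folklore] -/
theorem dC_cechObjMap (n : ℕ) (b : CechObj y M n) :
    dC n (cechObjMap y φ n b) = cechObjMap y φ (n + 1) (dC n b) := by
  show ((cechComplexMap y φ).f n ≫ (cechComplex y N).d n (n + 1)).hom b =
    ((cechComplex y M).d n (n + 1) ≫ (cechComplexMap y φ).f (n + 1)).hom b
  rw [(cechComplexMap y φ).comm]

/-- The augmentation is natural in the module, elementwise. [folklore] -/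
theorem cechAug_map (m : M) : cechAug y N (φ m) = cechObjMap y φ 0 (cechAug y M m) :=
  congrArg (fun f => f m) (congrArg DFunLike.coe (cechAug_comp y φ))

/-- `Č(y; -)` is `R`-linear in the map: the cochain map of `x • id` is `x • id`. [folklore] -/
theorem cechObjMap_smul_id (x : R) (n : ℕ) :
    cechObjMap y (x • (LinearMap.id : M →ₗ[R] M)) n = x • LinearMap.id := by
  refine LinearMap.ext fun c => funext fun t => ?_
  simp only [cechObjMap_apply, LinearMap.smul_apply, LinearMap.id_apply, Pi.smul_apply, locMap,
    LinearMap.map_smul, IsLocalizedModule.map_id]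

end Naturality

/-! ### Regular elements, reduction modulo `x` -/

/-- An `M`-regular element is `M_{y_t}`-regular. [folklore] -/
theorem isSMulRegular_cechLoc {x : R} (hx : IsSMulRegular M x) {n : ℕ} (t : Fin n → Fin s) :
    IsSMulRegular (CechLoc y M t) x := by
  intro a b hab
  induction a using LocalizedModule.induction_on with
  | h ma sa =>
    induction b using LocalizedModule.induction_on with
    | h mb sb =>
      simp only [LocalizedModule.smul'_mk, LocalizedModule.mk_eq] at hab ⊢
      obtain ⟨u, hu⟩ := hab
      refine ⟨u, hx ?_⟩
      dsimp only
      simp only [Submonoid.smul_def, smul_smul] at hu ⊢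
      rw [show x * (↑u * ↑sb) = ↑u * (↑sb * x) by ring, show x * (↑u * ↑sa) = ↑u * (↑sa * x) by ring]
      exact hu

/-- An `M`-regular element is `Č^n(y; M)`-regular. [folklore] -/
theorem isSMulRegular_cechObj {x : R} (hx : IsSMulRegular M x) (n : ℕ) :
    IsSMulRegular (CechObj y M n) x :=
  IsSMulRegular.pi fun t => isSMulRegular_cechLoc hx t

/-- `M →x M → M/xM` is exact. [folklore] -/
theorem exact_smul_id_toQuot (x : R) :
    Function.Exact (x • (LinearMap.id : M →ₗ[R] M)) (toQuot (M := M) x) := by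
  intro m
  simp only [Set.mem_range, LinearMap.smul_apply, LinearMap.id_apply]
  rw [Submodule.mkQ_apply, Submodule.Quotient.mk_eq_zero, Submodule.mem_smul_pointwise_iff_exists]
  constructor
  · rintro ⟨b, -, rfl⟩
    exact ⟨b, rfl⟩
  · rintro ⟨b, rfl⟩
    exact ⟨b, Submodule.mem_top, rfl⟩

/-- The kernel of `M → M/xM` is `xM`. [folklore] -/
theorem exists_eq_smul_of_toQuot_eq_zero (x : R) (m : M) (h : toQuot x m = 0) :
    ∃ m' : M, m = x • m' := by
  obtain ⟨m', hm'⟩ := ((exact_smul_id_toQuot (M := M) x) m).mp h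
  exact ⟨m', by simpa using hm'.symm⟩

/-- The kernel of `Č^n(M) → Č^n(M/xM)` is `x Č^n(M)`. [folklore] -/
theorem exists_eq_smul_of_cechObjMap_toQuot_eq_zero (x : R) (n : ℕ) (b : CechObj y M n)
    (h : cechObjMap y (toQuot (M := M) x) n b = 0) : ∃ b' : CechObj y M n, b = x • b' := by
  obtain ⟨b', hb'⟩ := ((cechObjMap_exact y _ _ (exact_smul_id_toQuot (M := M) x) n) b).mp h
  refine ⟨b', ?_⟩
  rw [cechObjMap_smul_id] at hb'
  simpa using hb'.symm

/-- `x` kills the Čech cochains of `M / x M`. [folklore] -/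
theorem smul_cechObj_quot (x : R) (n : ℕ) (c : CechObj y (QuotSMulTop x M) n) : x • c = 0 := by
  funext t
  rw [Pi.smul_apply, Pi.zero_apply]
  induction c t using LocalizedModule.induction_on with
  | h m k =>
    rw [LocalizedModule.smul'_mk]
    have : x • m = 0 := Module.mem_annihilator.mp (QuotSMulTop.mem_annihilator _ x) m
    rw [this, LocalizedModule.zero_mk]

/-- `x` kills `M/xM`. [folklore] -/
theorem smul_quot (x : R) (m : QuotSMulTop x M) : x • m = 0 :=
  Module.mem_annihilator.mp (QuotSMulTop.mem_annihilator _ x) m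

/-! ### From `y_j`-power torsion to `r`-power torsion for `r ∈ √(y)` -/

/-- If every `y_j` has a power killing `v`, so does every `r ∈ √(y_1, …, y_s)`. [folklore] -/
theorem exists_pow_smul_eq_zero_of_mem_radical {V : Type u} [AddCommGroup V] [Module R V] (v : V)
    (h : ∀ j : Fin s, ∃ N : ℕ, y j ^ N • v = 0) {r : R}
    (hr : r ∈ (Ideal.span (Set.range y)).radical) : ∃ K : ℕ, r ^ K • v = 0 := by
  have hle : Ideal.span (Set.range y) ≤ (Ideal.torsionOf R V v).radical := by
    rw [Ideal.span_le]
    rintro _ ⟨j, rfl⟩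
    obtain ⟨N, hN⟩ := h j
    exact ⟨N, (Ideal.mem_torsionOf_iff _ _).mpr hN⟩
  have hr' : r ∈ (Ideal.torsionOf R V v).radical := by
    have := Ideal.radical_mono hle hr
    rwa [Ideal.radical_idem] at this
  obtain ⟨K, hK⟩ := hr'
  exact ⟨K, (Ideal.mem_torsionOf_iff _ _).mp hK⟩

/-! ### The torsion statements in "coboundary up to a power of `r`" form -/

/-- Degree `0` torsion for `r ∈ √(y)`. [folklore] -/
theorem exists_pow_smul_eq_zero_of_cechAug_eq_zero' (m : M) (hm : cechAug y M m = 0) {r : R}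
    (hr : r ∈ (Ideal.span (Set.range y)).radical) : ∃ K : ℕ, r ^ K • m = 0 :=
  exists_pow_smul_eq_zero_of_mem_radical m
    (fun j => exists_pow_smul_eq_zero_of_cechAug_eq_zero m hm j) hr

/-- Degree `1` torsion for `r ∈ √(y)`: the classes of `Č^0`-cocycles modulo `ε(M)` are killed by a power of `r`. [folklore] -/
theorem exists_pow_smul_eq_cechAug' (c : CechObj y M 0) (hc : dC 0 c = 0) {r : R}
    (hr : r ∈ (Ideal.span (Set.range y)).radical) :
    ∃ (K : ℕ) (m : M), r ^ K • c = cechAug y M m := by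
  set Q := CechObj y M 0 ⧸ LinearMap.range (cechAug y M)
  have h : ∀ j : Fin s, ∃ N : ℕ, y j ^ N • (LinearMap.range (cechAug y M)).mkQ c = 0 := by
    intro j
    obtain ⟨N, m, hm⟩ := exists_pow_smul_eq_cechAug c hc j
    refine ⟨N, ?_⟩
    rw [← map_smul, hm, Submodule.mkQ_apply, Submodule.Quotient.mk_eq_zero]
    exact LinearMap.mem_range_self _ m
  obtain ⟨K, hK⟩ := exists_pow_smul_eq_zero_of_mem_radical _ h hr
  rw [← map_smul, Submodule.mkQ_apply, Submodule.Quotient.mk_eq_zero] at hK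
  obtain ⟨m, hm⟩ := hK
  exact ⟨K, m, hm.symm⟩

/-- Degrees `≥ 2` torsion for `r ∈ √(y)`. [folklore] -/
theorem exists_pow_smul_eq_dC' (q : ℕ) (c : CechObj y M (q + 1)) (hc : dC (q + 1) c = 0) {r : R}
    (hr : r ∈ (Ideal.span (Set.range y)).radical) :
    ∃ (K : ℕ) (b : CechObj y M q), r ^ K • c = dC q b := by
  have h : ∀ j : Fin s, ∃ N : ℕ, y j ^ N • (LinearMap.range (dC (y := y) (M := M) q)).mkQ c = 0 := by
    intro j
    obtain ⟨N, b, hb⟩ := exists_pow_smul_eq_dC q c hc j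
    refine ⟨N, ?_⟩
    rw [← map_smul, hb, Submodule.mkQ_apply, Submodule.Quotient.mk_eq_zero]
    exact LinearMap.mem_range_self _ b
  obtain ⟨K, hK⟩ := exists_pow_smul_eq_zero_of_mem_radical _ h hr
  rw [← map_smul, Submodule.mkQ_apply, Submodule.Quotient.mk_eq_zero] at hK
  obtain ⟨b, hb⟩ := hK
  exact ⟨K, b, hb.symm⟩

/-! ### Peeling off powers of a regular element -/

section Peel

variable {x : R} (hx : IsSMulRegular M x)
include hx

/-- Position `1`: if `M/xM → Č^0(M/xM)` is injective, then `x^K c = ε(b)` forces `c ∈ im ε`.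
[folklore] -/
theorem exists_eq_cechAug_of_pow_smul_eq
    (hE : ∀ m' : QuotSMulTop x M, cechAug y (QuotSMulTop x M) m' = 0 → m' = 0) :
    ∀ (K : ℕ) (c : CechObj y M 0) (b : M), x ^ K • c = cechAug y M b → ∃ b' : M, c = cechAug y M b' := by
  intro K
  induction K with
  | zero => intro c b h; exact ⟨b, by simpa using h⟩
  | succ K ih =>
    intro c b h
    -- `b̄` dies under the augmentation of `M/xM`, hence `b̄ = 0`, i.e. `b = x b''`
    have h1 : cechAug y (QuotSMulTop x M) (toQuot x b) = 0 := by
      rw [cechAug_map, ← h, LinearMap.map_smul, pow_succ, mul_smul, smul_comm,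
        smul_cechObj_quot]
    obtain ⟨b'', rfl⟩ := exists_eq_smul_of_toQuot_eq_zero x b (hE _ h1)
    rw [LinearMap.map_smul, pow_succ, mul_smul, smul_comm] at h
    exact ih c b'' (isSMulRegular_cechObj hx 0 h)

/-- Position `2`: if `Č(M/xM)` is exact at `Č^0`, then `x^K c = d b` forces `c ∈ im d`.
[folklore] -/
theorem exists_eq_dC_zero_of_pow_smul_eq
    (hE : ∀ c' : CechObj y (QuotSMulTop x M) 0, dC 0 c' = 0 →
      ∃ m' : QuotSMulTop x M, cechAug y (QuotSMulTop x M) m' = c') :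
    ∀ (K : ℕ) (c : CechObj y M 1) (b : CechObj y M 0), x ^ K • c = dC 0 b →
      ∃ b' : CechObj y M 0, c = dC 0 b' := by
  intro K
  induction K with
  | zero => intro c b h; exact ⟨b, by simpa using h⟩
  | succ K ih =>
    intro c b h
    have h1 : dC 0 (cechObjMap y (toQuot x) 0 b) = 0 := by
      rw [dC_cechObjMap, ← h, LinearMap.map_smul, pow_succ, mul_smul, smul_comm,
        smul_cechObj_quot]
    obtain ⟨a', ha'⟩ := hE _ h1
    obtain ⟨a, rfl⟩ := toQuot_surjective x a'
    rw [cechAug_map] at ha'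
    have h2 : cechObjMap y (toQuot x) 0 (b - cechAug y M a) = 0 := by
      rw [map_sub, ha', sub_self]
    obtain ⟨b'', hb''⟩ := exists_eq_smul_of_cechObjMap_toQuot_eq_zero x 0 _ h2
    rw [sub_eq_iff_eq_add] at hb''
    rw [hb'', map_add, dC_cechAug, add_zero, LinearMap.map_smul, pow_succ, mul_smul,
      smul_comm] at h
    exact ih c b'' (isSMulRegular_cechObj hx 1 h)

/-- Positions `≥ 3`: if `Č(M/xM)` is exact at `Č^{n+1}`, then `x^K c = d b` forces `c ∈ im d`.
[folklore] -/
theorem exists_eq_dC_succ_of_pow_smul_eq (n : ℕ)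
    (hE : ∀ c' : CechObj y (QuotSMulTop x M) (n + 1), dC (n + 1) c' = 0 →
      ∃ a' : CechObj y (QuotSMulTop x M) n, dC n a' = c') :
    ∀ (K : ℕ) (c : CechObj y M (n + 2)) (b : CechObj y M (n + 1)), x ^ K • c = dC (n + 1) b →
      ∃ b' : CechObj y M (n + 1), c = dC (n + 1) b' := by
  intro K
  induction K with
  | zero => intro c b h; exact ⟨b, by simpa using h⟩
  | succ K ih =>
    intro c b h
    have h1 : dC (n + 1) (cechObjMap y (toQuot x) (n + 1) b) = 0 := by
      rw [dC_cechObjMap, ← h, LinearMap.map_smul, pow_succ, mul_smul, smul_comm,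
        smul_cechObj_quot]
    obtain ⟨a', ha'⟩ := hE _ h1
    obtain ⟨a, rfl⟩ := cechObjMap_surjective y (toQuot x) (toQuot_surjective x) n a'
    rw [dC_cechObjMap] at ha'
    have h2 : cechObjMap y (toQuot x) (n + 1) (b - dC n a) = 0 := by
      rw [map_sub, ha', sub_self]
    obtain ⟨b'', hb''⟩ := exists_eq_smul_of_cechObjMap_toQuot_eq_zero x (n + 1) _ h2
    rw [sub_eq_iff_eq_add] at hb''
    rw [hb'', map_add, dC_dC, add_zero, LinearMap.map_smul, pow_succ, mul_smul, smul_comm] at h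
    exact ih c b'' (isSMulRegular_cechObj hx (n + 2) h)

end Peel

/-! ### The main theorem -/

/-- **Local (Čech) cohomology vanishes below the depth** (Grothendieck, SGA 2 III 3.1–3.3;
Eisenbud, Thm. A1.3 with Prop. A1.16 (1)): if the module `M` has an `M`-regular sequence
`x_1, …, x_t` with
all `x_l ∈ √(y_1, …, y_s)`, then the extended Čech complex
`0 → M → ∏ M_{y_i} → ∏ M_{y_i y_j} → ⋯` is exact in (cochain) degrees `< t`; concretely the three
clauses below. Proof by induction on `t` (`x = x_1` is `M`-regular and `x_2, …` is
`M/xM`-regular): a cocycle `c` is killed into the coboundaries by a power `x^K` (the classes are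
`y_j`-power torsion, `exists_pow_smul_eq_dC`, and `x ∈ √(y)`), and the powers of `x` are peeled
off one at a time using the exactness of `Č(y; M/xM)` one degree lower and
`0 → Č(M) →x Č(M) → Č(M/xM) → 0` (`exists_eq_dC_succ_of_pow_smul_eq`).
[cite: Grothendieck1968SGA2, Exp. III 3.1–3.3] [cite: Eisenbud2005, Prop. A1.16 (1) with Thm. A1.3] -/
theorem cech_exact_of_isRegular (rs : List R) :
    ∀ (M : Type u) [AddCommGroup M] [Module R M],
      RingTheory.Sequence.IsRegular M rs → (∀ r ∈ rs, r ∈ (Ideal.span (Set.range y)).radical) →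
      (0 < rs.length → ∀ m : M, cechAug y M m = 0 → m = 0) ∧
      (1 < rs.length → ∀ c : CechObj y M 0, dC 0 c = 0 → ∃ m : M, cechAug y M m = c) ∧
      (∀ n : ℕ, n + 2 < rs.length →
        ∀ c : CechObj y M (n + 1), dC (n + 1) c = 0 → ∃ b : CechObj y M n, dC n b = c) := by
  induction rs with
  | nil =>
    intro M _ _ _ _
    exact ⟨fun h => absurd h (by simp), fun h => absurd h (by simp), fun n h => absurd h (by simp)⟩
  | cons x rs ih =>
    intro M _ _ hreg hrad
    rw [RingTheory.Sequence.isRegular_cons_iff] at hreg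
    obtain ⟨hx, hreg'⟩ := hreg
    have hxrad : x ∈ (Ideal.span (Set.range y)).radical := hrad x (by simp)
    obtain ⟨ih0, ih1, ih2⟩ := ih (QuotSMulTop x M) hreg' fun r hr => hrad r (by simp [hr])
    refine ⟨fun _ m hm => ?_, fun hlen c hc => ?_, fun n hlen c hc => ?_⟩
    · -- degree 0: `x^K m = 0` and `x^K` is `M`-regular
      obtain ⟨K, hK⟩ := exists_pow_smul_eq_zero_of_cechAug_eq_zero' m hm hxrad
      exact (hx.pow K) (by simpa using hK)
    · -- degree 1
      obtain ⟨K, b, hb⟩ := exists_pow_smul_eq_cechAug' c hc hxrad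
      obtain ⟨b', hb'⟩ := exists_eq_cechAug_of_pow_smul_eq hx
        (ih0 (by simpa using hlen)) K c b hb
      exact ⟨b', hb'.symm⟩
    · -- degrees `≥ 2`
      obtain ⟨K, b, hb⟩ := exists_pow_smul_eq_dC' n c hc hxrad
      cases n with
      | zero =>
        obtain ⟨b', hb'⟩ := exists_eq_dC_zero_of_pow_smul_eq hx
          (ih1 (by simp at hlen; omega)) K c b hb
        exact ⟨b', hb'.symm⟩
      | succ n =>
        obtain ⟨b', hb'⟩ := exists_eq_dC_succ_of_pow_smul_eq hx n
          (ih2 n (by simp at hlen; omega)) K c b hb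
        exact ⟨b', hb'.symm⟩

end Depth

end Literature.RingTheory.LocalCohomology

end
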